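import Summits.HubbardSuperconductivity.HubbardSuperconductivity.Theses.HyperoctahedralMott
import Literature.MathematicalPhysics.QuantumLattice.SusyTJBondIdentity

/-!
# Route `HyperoctahedralMott`, support `SusyInterchangeIdentity` (item stmt-HubbardSuperconductivity-6675)

Card D5, the supersymmetric point of the `t`-`J` model as a sum of graded transpositions
(Sarkar 1991; Essler–Korepin 1992): for every finite graph `G` and hopping `t`, with
`P = gutzwillerProj`, `B_{xy} = c_{x↑}c_{y↓} − c_{x↓}c_{y↑}`, the graded site swap
`π(xy) = Π_σ [1 − (c†_{xσ} − c†_{yσ})(c_{xσ} − c_{yσ})]` and `n^s_x = n_{x↑} + n_{x↓} − 2 n_{x↑}n_{x↓}`,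

  `P [hamiltonian G t 0 − (t/2) Σ_{x,y adj} B_{xy}†B_{xy}] P
     = P [−(t/2) Σ_{x,y adj} π(xy) − t Σ_x deg(x) (n^s_x − ½)] P`.

Proof: the bond-local identity `P (T_{xy} + B_{xy}†B_{xy}) P = P (π(xy) + n^s_x + n^s_y − 1) P`
(`Literature.…SusyTJ.gutzwiller_bond_identity`, `x ≠ y`) is multiplied by `−t/2` and summed over
ordered edges; the hopping term of `hamiltonian G t 0` is `−t Σ_{(x,y) adj} Σ_σ c†_{xσ}c_{yσ}`,
i.e. `−(t/2)` times the symmetrised bond hopping, and `Σ_{(x,y) adj} (n^s_x + n^s_y − 1)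
= 2 Σ_x deg(x)(n^s_x − ½)`. The bookkeeping (distributing the sandwich over the edge sum,
symmetrising in `(x,y)`, degree sums) is done once abstractly in `sandwich_edge_sum_assembly`.
-/

-- the mandated namespace `Summit.<Summit>.<Problem>.Theorems` repeats `HubbardSuperconductivity`
-- (single-problem summit, D-0017), which the `dupNamespace` linter flags on every declaration
set_option linter.dupNamespace false

noncomputable section

namespace Summit.HubbardSuperconductivity.HubbardSuperconductivity.Theorems.HyperoctahedralMott

open Matrix Literature.MathematicalPhysics.QuantumLattice

/-- **Edge-sum assembly of a bond identity (abstract bookkeeping).** In a matrix ring, if a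
sandwich `P (·) P` identifies, on every pair of distinct sites, the symmetrised bond hopping plus
pair density `Σ_σ (a_{xyσ} + a_{yxσ}) + B2_{xy}` with `Sw_{xy} + nS_x + nS_y − 1`, then summing
over the ordered edges of a finite simple graph `G` with weight `−t/2` gives
`P [−t ΣΣΣ_σ [x∼y] a_{xyσ} + 0·D − (t/2) ΣΣ [x∼y] B2_{xy}] P
 = P [−(t/2) ΣΣ [x∼y] Sw_{xy} − t Σ_x deg(x) (nS_x − ½)] P`. [folklore] -/
theorem sandwich_edge_sum_assembly {n Λ : Type*} [Fintype n] [DecidableEq n] [Fintype Λ]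
    (G : SimpleGraph Λ) [DecidableRel G.Adj] (P D : Matrix n n ℂ)
    (a : Λ → Λ → Fin 2 → Matrix n n ℂ) (B2 Sw : Λ → Λ → Matrix n n ℂ) (nS : Λ → Matrix n n ℂ)
    (t : ℝ)
    (bond : ∀ x y, x ≠ y →
      P * ((∑ σ, (a x y σ + a y x σ)) + B2 x y) * P = P * (Sw x y + nS x + nS y - 1) * P) :
    P * ((-(t : ℂ) • (∑ x, ∑ y, ∑ σ, if G.Adj x y then a x y σ else 0) + ((0 : ℝ) : ℂ) • D) -
          ((t / 2 : ℝ) : ℂ) • ∑ x, ∑ y, (if G.Adj x y then B2 x y else 0)) * P =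
      P * (-(((t / 2 : ℝ) : ℂ) • ∑ x, ∑ y, (if G.Adj x y then Sw x y else 0)) -
          (t : ℂ) • ∑ x, ((G.degree x : ℕ) : ℂ) • (nS x - (1 / 2 : ℂ) • (1 : Matrix n n ℂ))) * P := by
  set c : ℂ := ((t / 2 : ℝ) : ℂ) with hc
  have ht : (t : ℂ) = c + c := by rw [hc]; push_cast; ring
  -- the per-edge summands of the two sides
  set f : Λ → Λ → Matrix n n ℂ := fun x y => -(t : ℂ) • (∑ σ, a x y σ) - c • B2 x y with hf
  set g : Λ → Λ → Matrix n n ℂ := fun x y =>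
    -(c • Sw x y) - (t : ℂ) • (nS x - (1 / 2 : ℂ) • (1 : Matrix n n ℂ)) with hg
  -- Step 1: both inner operators are sums over ordered edges
  have hX : (-(t : ℂ) • (∑ x, ∑ y, ∑ σ, if G.Adj x y then a x y σ else 0) + ((0 : ℝ) : ℂ) • D) -
      c • ∑ x, ∑ y, (if G.Adj x y then B2 x y else 0) =
      ∑ x, ∑ y, if G.Adj x y then f x y else 0 := by
    rw [Complex.ofReal_zero, zero_smul, add_zero, Finset.smul_sum, Finset.smul_sum,
      ← Finset.sum_sub_distrib]
    refine Finset.sum_congr rfl fun x _ => ?_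
    rw [Finset.smul_sum, Finset.smul_sum, ← Finset.sum_sub_distrib]
    refine Finset.sum_congr rfl fun y _ => ?_
    rw [Finset.sum_ite_irrel, Finset.sum_const_zero]
    split_ifs
    · rfl
    · rw [smul_zero, smul_zero, sub_zero]
  have hdeg : (∑ x, ((G.degree x : ℕ) : ℂ) • (nS x - (1 / 2 : ℂ) • (1 : Matrix n n ℂ))) =
      ∑ x, ∑ y, if G.Adj x y then (nS x - (1 / 2 : ℂ) • (1 : Matrix n n ℂ)) else 0 :=
    Finset.sum_congr rfl fun x _ => SusyTJ.degree_smul_eq_sum_adj G x _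
  have hY : -(c • ∑ x, ∑ y, (if G.Adj x y then Sw x y else 0)) -
      (t : ℂ) • ∑ x, ((G.degree x : ℕ) : ℂ) • (nS x - (1 / 2 : ℂ) • (1 : Matrix n n ℂ)) =
      ∑ x, ∑ y, if G.Adj x y then g x y else 0 := by
    rw [hdeg, Finset.smul_sum, Finset.smul_sum, ← Finset.sum_neg_distrib, ← Finset.sum_sub_distrib]
    refine Finset.sum_congr rfl fun x _ => ?_
    rw [Finset.smul_sum, Finset.smul_sum, ← Finset.sum_neg_distrib, ← Finset.sum_sub_distrib]
    refine Finset.sum_congr rfl fun y _ => ?_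
    split_ifs
    · rfl
    · rw [smul_zero, neg_zero, smul_zero, sub_zero]
  -- Step 2: the sandwich distributes over an edge sum
  have hsand : ∀ k : Λ → Λ → Matrix n n ℂ,
      P * (∑ x, ∑ y, if G.Adj x y then k x y else 0) * P =
        ∑ x, ∑ y, if G.Adj x y then P * k x y * P else 0 := by
    intro k
    rw [Finset.mul_sum, Finset.sum_mul]
    refine Finset.sum_congr rfl fun x _ => ?_
    rw [Finset.mul_sum, Finset.sum_mul]
    refine Finset.sum_congr rfl fun y _ => ?_
    split_ifs
    · rfl
    · rw [mul_zero, zero_mul]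
  rw [hX, hY, hsand f, hsand g]
  -- Step 3: the symmetrised summands agree on every edge, by the bond identity
  refine SusyTJ.sum_adj_eq_of_symm_eq G _ _ fun x y hxy => ?_
  have hne : x ≠ y := G.ne_of_adj hxy
  have hfs : f x y + f y x =
      -c • ((∑ σ, (a x y σ + a y x σ)) + B2 x y + ((∑ σ, (a y x σ + a x y σ)) + B2 y x)) := by
    simp only [hf, Finset.sum_add_distrib, ht]
    module
  have hgs : g x y + g y x =
      -c • ((Sw x y + nS x + nS y - 1) + (Sw y x + nS y + nS x - 1)) := by
    simp only [hg, ht]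
    module
  calc P * f x y * P + P * f y x * P = P * (f x y + f y x) * P := by rw [mul_add, add_mul]
    _ = -c • (P * ((∑ σ, (a x y σ + a y x σ)) + B2 x y) * P +
          P * ((∑ σ, (a y x σ + a x y σ)) + B2 y x) * P) := by
        rw [hfs, Matrix.mul_smul, Matrix.smul_mul, mul_add, add_mul]
    _ = -c • (P * (Sw x y + nS x + nS y - 1) * P + P * (Sw y x + nS y + nS x - 1) * P) := by
        rw [bond x y hne, bond y x hne.symm]
    _ = P * (g x y + g y x) * P := by rw [hgs, Matrix.mul_smul, Matrix.smul_mul, mul_add, add_mul]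
    _ = P * g x y * P + P * g y x * P := by rw [mul_add, add_mul]

/-- **`SusyInterchangeIdentity`** (route `HyperoctahedralMott`, item stmt-HubbardSuperconductivity-6675;
Sarkar 1991, Essler–Korepin 1992): on the Gutzwiller space the `t`-`J` Hamiltonian at its
supersymmetric point `J = 2t`, `hamiltonian G t 0 − (t/2) Σ_{x,y adj} B_{xy}†B_{xy}`, equals
`−(t/2) Σ_{x,y adj} π(xy) − t Σ_x deg(x)(n^s_x − ½)`, both sandwiched by `gutzwillerProj`.
[cite: Sarkar1991, eq. (2)–(4)] -/
theorem susyInterchangeIdentity_proof :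
    Summit.HubbardSuperconductivity.HubbardSuperconductivity.Theses.HyperoctahedralMott.SusyInterchangeIdentity := by
  intro Λ _ _ G _ t Sw B nS P
  rw [hamiltonian]
  exact sandwich_edge_sum_assembly G P _ (fun x y σ => creation (orb x σ) * annihilation (orb y σ))
    (fun x y => (B x y)ᴴ * B x y) Sw nS t (fun x y hxy => SusyTJ.gutzwiller_bond_identity hxy)

end Summit.HubbardSuperconductivity.HubbardSuperconductivity.Theorems.HyperoctahedralMott

end
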